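import Literature.NumberTheory.BeurlingPrimes.BDRMultisetFubini
import Literature.NumberTheory.BeurlingPrimes.LiStieltjes
import Literature.NumberTheory.BeurlingPrimes.BVContinuation
import HarnessLib

/-!
# The BDR template as a Stieltjes function: the hypotheses of the Broucke–Vindas discretization theorem

Topic `Literature/NumberTheory/BeurlingPrimes`, grouping namespace `BDRMultiset`. Everything in this file is PROVED.

Broucke–Debruyne–Révész (2023), proof of Theorem 3.2: "In view of Lemma 3.1, there is `M` such that the function `F`
from (3.1) is strictly increasing. We now apply the random prime construction result of Theorem 1.2 for this function
`F`, on noting that `F` is continuous, obviously satisfies `F(1) = 0`, and admits a bound `F(x) ≪ x/log x`."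
Theorem 1.2 is the tree's (now proved) `BrouckeVindas2024_thm12`, stated over Mathlib's `StieltjesFunction`. This
file packages the real-part template `F = BDR.tmplF` of `BDRMultisetTemplate.lean` accordingly, under the hypothesis
`NF ≥ 0` on `(0,∞)` furnished by Lemma 3.1 (`BDRMultiset.exists_M0_NF_pos`):

* a generic construction `stieltjesOfMonotone` and the generic identification of the Stieltjes measure of a
  continuous monotone `F` vanishing on `(−∞,1]` with density `f = F′` on `(1,∞)` (`measure_stieltjesOfMonotone`,
  `stieltjesExpSum_eq_tmplSum`: `∫_{[1,x]} u^{−it} dF(u) = ∫₁ˣ f(u) u^{−it} du = BV.tmplSum f x t`), following the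
  tree's `LiStieltjes.lean` for `li`;
* for the template: `F` is non-negative and monotone (`tmplF_nonneg`, `monotone_tmplF`), `F(x) ≤ K Li(x) ≤ 2K x/log x`
  (`tmplF_le_mul_Li`, `tmplF_chebyshev`, comparing derivatives with `Li′ = (1 − 1/u)/log u`), `F → ∞`
  (`tendsto_tmplF_atTop`, from `NF₀(log x) ≥ x/2`), and the identities above with `f = densF`.

## References
* [BrouckeDebruyneRevesz2023] F. Broucke, G. Debruyne, Sz. Gy. Révész, *Some examples of well-behaved Beurling
  number systems*, arXiv:2309.01567, proof of Theorem 3.2 (first paragraph) (read).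
* [BrouckeVindas2024] F. Broucke, J. Vindas, Math. Z. 307 (2024), Theorem 1.2 (the discretization theorem).
-/

noncomputable section

open Filter Topology Complex Set MeasureTheory intervalIntegral
open scoped ENNReal NNReal

namespace Literature.NumberTheory.BeurlingPrimes

/-! ### Generic: a continuous monotone function as a Stieltjes function with density -/

/-- A monotone continuous function as a Stieltjes function. [folklore] -/
def stieltjesOfMonotone (F : ℝ → ℝ) (hF : Monotone F) (hc : Continuous F) : StieltjesFunction ℝ where
  toFun := F
  mono' := hF
  right_continuous' _ := hc.continuousWithinAt

/-- `stieltjesOfMonotone F … x = F x`. [folklore] -/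
@[simp] theorem stieltjesOfMonotone_apply (F : ℝ → ℝ) (hF : Monotone F) (hc : Continuous F) (x : ℝ) :
    stieltjesOfMonotone F hF hc x = F x := rfl

section Generic

variable {F f : ℝ → ℝ} {C : ℝ}

/-- **`∫ₐᵇ f = F b − F a`** for a continuous `F` vanishing on `(−∞,1]` with `F′ = f` on `(1,∞)`, `f = 0` on `(−∞,1]`,
`f` measurable and bounded (split at `1`). [folklore] -/
theorem integral_density_eq (hc : Continuous F) (hF1 : ∀ x, x ≤ 1 → F x = 0)
    (hderiv : ∀ x, 1 < x → HasDerivAt F (f x) x) (hf1 : ∀ x, x ≤ 1 → f x = 0) (hfm : Measurable f)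
    (hfC : ∀ x, |f x| ≤ C) {a b : ℝ} (hab : a ≤ b) : ∫ u in a..b, f u = F b - F a := by
  have hint : ∀ a b : ℝ, IntervalIntegrable f volume a b := fun a b ↦
    intervalIntegrable_iff.mpr (Measure.integrableOn_of_bounded (M := C) measure_Ioc_lt_top.ne hfm.aestronglyMeasurable
      (Eventually.of_forall fun u ↦ by rw [Real.norm_eq_abs]; exact hfC u))
  have hleft : ∀ {a b : ℝ}, a ≤ b → b ≤ 1 → ∫ u in a..b, f u = F b - F a := by
    intro a b hab hb1
    rw [hF1 b hb1, hF1 a (hab.trans hb1), sub_zero]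
    rw [intervalIntegral.integral_congr (g := fun _ ↦ (0 : ℝ)) fun u hu ↦ ?_]
    · simp
    · rw [uIcc_of_le hab] at hu
      exact hf1 u (hu.2.trans hb1)
  have hright : ∀ {a b : ℝ}, a ≤ b → 1 ≤ a → ∫ u in a..b, f u = F b - F a := by
    intro a b hab ha1
    exact intervalIntegral.integral_eq_sub_of_hasDerivAt_of_le hab hc.continuousOn
      (fun u hu ↦ hderiv u (lt_of_le_of_lt ha1 hu.1)) (hint a b)
  rcases le_or_gt b 1 with hb1 | hb1
  · exact hleft hab hb1
  rcases le_or_gt 1 a with ha1 | ha1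
  · exact hright hab ha1
  · have h1 : ∫ u in a..b, f u = (∫ u in a..1, f u) + ∫ u in (1:ℝ)..b, f u :=
      (intervalIntegral.integral_add_adjacent_intervals (hint a 1) (hint 1 b)).symm
    rw [h1, hleft ha1.le le_rfl, hright hb1.le le_rfl, hF1 1 le_rfl, hF1 a ha1.le]
    ring

/-- **`dF = f(u) du`**: the Stieltjes measure of `F` is Lebesgue measure with density `f` (hypotheses as in
`integral_density_eq`, plus `F` monotone and `f ≥ 0`). [folklore] -/
theorem measure_stieltjesOfMonotone (hF : Monotone F) (hc : Continuous F) (hF1 : ∀ x, x ≤ 1 → F x = 0)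
    (hderiv : ∀ x, 1 < x → HasDerivAt F (f x) x) (hf1 : ∀ x, x ≤ 1 → f x = 0) (hfm : Measurable f)
    (hf0 : ∀ x, 0 ≤ f x) (hfC : ∀ x, |f x| ≤ C) :
    (stieltjesOfMonotone F hF hc).measure = volume.withDensity (fun u ↦ ENNReal.ofReal (f u)) := by
  refine Measure.ext_of_Ioc _ _ fun a b hab ↦ ?_
  have hint : IntegrableOn f (Ioc a b) :=
    Measure.integrableOn_of_bounded (M := C) measure_Ioc_lt_top.ne hfm.aestronglyMeasurable
      (Eventually.of_forall fun u ↦ by rw [Real.norm_eq_abs]; exact hfC u)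
  rw [StieltjesFunction.measure_Ioc, withDensity_apply _ measurableSet_Ioc, stieltjesOfMonotone_apply,
    stieltjesOfMonotone_apply, ← ofReal_integral_eq_lintegral_ofReal hint (Eventually.of_forall fun u ↦ hf0 u),
    ← intervalIntegral.integral_of_le hab.le, integral_density_eq hc hF1 hderiv hf1 hfm hfC hab.le]

/-- **The template side of (1.3)**: `∫_{[1,x]} u^{−it} dF(u) = ∫₁ˣ f(u) u^{−it} du = BV.tmplSum f x t` for `x ≥ 1`.
[cite: BrouckeVindas2024, Theorem 1.2] -/
theorem stieltjesExpSum_eq_tmplSum (hF : Monotone F) (hc : Continuous F) (hF1 : ∀ x, x ≤ 1 → F x = 0)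
    (hderiv : ∀ x, 1 < x → HasDerivAt F (f x) x) (hf1 : ∀ x, x ≤ 1 → f x = 0) (hfm : Measurable f)
    (hf0 : ∀ x, 0 ≤ f x) (hfC : ∀ x, |f x| ≤ C) {x : ℝ} (hx : 1 ≤ x) (t : ℝ) :
    stieltjesExpSum (stieltjesOfMonotone F hF hc) x t = BV.tmplSum f x t := by
  rw [stieltjesExpSum, measure_stieltjesOfMonotone hF hc hF1 hderiv hf1 hfm hf0 hfC]
  have hdens : (fun u ↦ ENNReal.ofReal (f u)) = fun u ↦ ((Real.toNNReal (f u) : ℝ≥0) : ℝ≥0∞) := rfl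
  rw [hdens, setIntegral_withDensity_eq_setIntegral_smul hfm.real_toNNReal _ measurableSet_Icc,
    integral_Icc_eq_integral_Ioc, BV.tmplSum, intervalIntegral.integral_of_le hx]
  refine setIntegral_congr_fun measurableSet_Ioc fun u _ ↦ ?_
  rw [BV.tmplIntegrand, NNReal.smul_def, Real.coe_toNNReal _ (hf0 u), Complex.real_smul]

/-- Monotonicity from a non-negative derivative on `(1,∞)`, continuity, and vanishing on `(−∞,1]`. [folklore] -/
theorem monotone_of_density (hc : Continuous F) (hF1 : ∀ x, x ≤ 1 → F x = 0)
    (hderiv : ∀ x, 1 < x → HasDerivAt F (f x) x) (hf0 : ∀ x, 0 ≤ f x) : Monotone F := by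
  have hmono : MonotoneOn F (Ici 1) := by
    refine monotoneOn_of_deriv_nonneg (convex_Ici 1) hc.continuousOn ?_ ?_
    · rw [interior_Ici]
      exact fun x hx ↦ (hderiv x hx).differentiableAt.differentiableWithinAt
    · rw [interior_Ici]
      intro x hx
      rw [(hderiv x hx).deriv]; exact hf0 x
  intro x y hxy
  rcases le_or_gt y 1 with hy1 | hy1
  · rw [hF1 y hy1, hF1 x (hxy.trans hy1)]
  rcases le_or_gt x 1 with hx1 | hx1
  · rw [hF1 x hx1, ← hF1 1 le_rfl]
    exact hmono (self_mem_Ici) (le_of_lt hy1 : (1:ℝ) ≤ y) hy1.le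
  · exact hmono (le_of_lt hx1 : (1:ℝ) ≤ x) (le_of_lt hy1 : (1:ℝ) ≤ y) hxy

end Generic

/-! ### The template `F = BDR.tmplF` -/

namespace BDRMultiset

variable {R S : Multiset ℂ} {δ : ℝ} {M : ℕ}

/-- `densF ≥ 0` when `NF ≥ 0` on `(0, ∞)`. [cite: BrouckeDebruyneRevesz2023, Lemma 3.1] -/
theorem densF_nonneg (hpos : ∀ L : ℝ, 0 < L → 0 ≤ NF R S δ M L) (u : ℝ) : 0 ≤ densF R S δ M u := by
  by_cases hu : 1 < u
  · rw [densF_of_one_lt hu]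
    exact div_nonneg (hpos _ (Real.log_pos hu)) (mul_nonneg (by linarith) (Real.log_pos hu).le)
  · rw [densF_of_le_one (not_lt.1 hu)]

/-- **`F` is monotone** when `NF ≥ 0` on `(0,∞)` (`0 ≤ δ ≤ 1`). [cite: BrouckeDebruyneRevesz2023, Lemma 3.1] -/
theorem monotone_tmplF (hδ : 0 ≤ δ) (hδ1 : δ ≤ 1) (hpos : ∀ L : ℝ, 0 < L → 0 ≤ NF R S δ M L) :
    Monotone (tmplF R S δ M) :=
  monotone_of_density (continuous_tmplF hδ hδ1) (fun _ hx ↦ tmplF_of_le_one hx)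
    (fun _ hx ↦ hasDerivAt_tmplF hδ hδ1 hx) (densF_nonneg hpos)

/-- `F ≥ 0`. [cite: BrouckeDebruyneRevesz2023, Lemma 3.1] -/
theorem tmplF_nonneg (hδ : 0 ≤ δ) (hδ1 : δ ≤ 1) (hpos : ∀ L : ℝ, 0 < L → 0 ≤ NF R S δ M L) (x : ℝ) :
    0 ≤ tmplF R S δ M x := by
  rcases le_or_gt x 1 with hx | hx
  · rw [tmplF_of_le_one hx]
  · rw [← tmplF_of_le_one (R := R) (S := S) (δ := δ) (M := M) le_rfl]
    exact monotone_tmplF hδ hδ1 hpos hx.le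

/-- The Stieltjes function of the template. [cite: BrouckeDebruyneRevesz2023, proof of Theorem 3.2] -/
def tmplStieltjes (hδ : 0 ≤ δ) (hδ1 : δ ≤ 1) (hpos : ∀ L : ℝ, 0 < L → 0 ≤ NF R S δ M L) : StieltjesFunction ℝ :=
  stieltjesOfMonotone (tmplF R S δ M) (monotone_tmplF hδ hδ1 hpos) (continuous_tmplF hδ hδ1)

/-- `tmplStieltjes x = F x`. [folklore] -/
@[simp] theorem tmplStieltjes_apply (hδ : 0 ≤ δ) (hδ1 : δ ≤ 1) (hpos : ∀ L : ℝ, 0 < L → 0 ≤ NF R S δ M L) (x : ℝ) :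
    tmplStieltjes hδ hδ1 hpos x = tmplF R S δ M x := rfl

/-- **`dF = densF(u) du`** for the template. [cite: BrouckeDebruyneRevesz2023, proof of Theorem 3.2] -/
theorem measure_tmplStieltjes (hS : ∀ ω ∈ S, ω.re ≤ 1) (hR : ∀ ρ ∈ R, ρ.re ≤ 1) (hδ : 0 ≤ δ) (hδ1 : δ ≤ 1)
    (hpos : ∀ L : ℝ, 0 < L → 0 ≤ NF R S δ M L) :
    (tmplStieltjes hδ hδ1 hpos).measure = volume.withDensity (fun u ↦ ENNReal.ofReal (densF R S δ M u)) :=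
  measure_stieltjesOfMonotone _ _ (fun _ hx ↦ tmplF_of_le_one hx) (fun _ hx ↦ hasDerivAt_tmplF hδ hδ1 hx)
    (fun _ hu ↦ densF_of_le_one hu) (measurable_densF hδ hδ1) (densF_nonneg hpos)
    (abs_densF_le hS hR hδ hδ1 fun _ hx ↦ hpos _ (Real.log_pos hx))

/-- **`∫_{[1,x]} u^{−it} dF(u) = BV.tmplSum densF x t`** for the template (`x ≥ 1`).
[cite: BrouckeDebruyneRevesz2023, proof of Theorem 3.2] -/
theorem stieltjesExpSum_tmplStieltjes (hS : ∀ ω ∈ S, ω.re ≤ 1) (hR : ∀ ρ ∈ R, ρ.re ≤ 1) (hδ : 0 ≤ δ) (hδ1 : δ ≤ 1)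
    (hpos : ∀ L : ℝ, 0 < L → 0 ≤ NF R S δ M L) {x : ℝ} (hx : 1 ≤ x) (t : ℝ) :
    stieltjesExpSum (tmplStieltjes hδ hδ1 hpos) x t = BV.tmplSum (densF R S δ M) x t :=
  stieltjesExpSum_eq_tmplSum _ _ (fun _ hx ↦ tmplF_of_le_one hx) (fun _ hx ↦ hasDerivAt_tmplF hδ hδ1 hx)
    (fun _ hu ↦ densF_of_le_one hu) (measurable_densF hδ hδ1) (densF_nonneg hpos)
    (abs_densF_le hS hR hδ hδ1 fun _ hx ↦ hpos _ (Real.log_pos hx)) hx t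

/-! ### The Chebyshev bound `F(x) ≤ K Li(x) ≤ 2K x/log x` -/

/-- `(1 − 1/u)/log u ≥ 1/2 · min(1, 1/log u)`: on `(1, 2]`, `(1 − 1/u)/log u ≥ 1/2`; on `[2, ∞)`, `≥ 1/(2 log u)`.
In the combined form: `1 ≤ 2(1 − 1/u)/log u · max 1 (log u)`… we use the two cases separately. [folklore] -/
theorem half_le_Li_integrand {u : ℝ} (hu : 1 < u) (hu2 : u ≤ 2) : 1 / 2 ≤ (1 - u⁻¹) / Real.log u := by
  have hu0 : 0 < u := by linarith
  have hlog : 0 < Real.log u := Real.log_pos hu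
  have h1 : Real.log u ≤ u - 1 := by linarith [Real.log_le_sub_one_of_pos hu0]
  rw [le_div_iff₀ hlog]
  have h2 : 1 - u⁻¹ = (u - 1) / u := by field_simp
  rw [h2, le_div_iff₀ hu0]
  nlinarith

/-- `1/(2 log u) ≤ (1 − 1/u)/log u` for `u ≥ 2`. [folklore] -/
theorem inv_two_log_le_Li_integrand {u : ℝ} (hu2 : 2 ≤ u) : 1 / (2 * Real.log u) ≤ (1 - u⁻¹) / Real.log u := by
  have hu0 : 0 < u := by linarith
  have hlog : 0 < Real.log u := Real.log_pos (by linarith)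
  rw [div_le_div_iff₀ (by positivity) hlog]
  have : u⁻¹ ≤ 1 / 2 := by rw [inv_le_comm₀ hu0 (by norm_num)]; norm_num; linarith
  nlinarith

/-- `densF u ≤ K · (1 − 1/u)/log u` for `u > 1` with `K = 2(C_glob + C_F)`, where `C_glob` bounds `|densF|` and
`densF ≤ C_F/log u`. [cite: BrouckeDebruyneRevesz2023, proof of Theorem 3.2] -/
theorem densF_le_mul_Li_integrand (hS : ∀ ω ∈ S, ω.re ≤ 1) (hR : ∀ ρ ∈ R, ρ.re ≤ 1) (hδ : 0 ≤ δ) (hδ1 : δ ≤ 1)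
    (hpos : ∀ L : ℝ, 0 < L → 0 ≤ NF R S δ M L) {u : ℝ} (hu : 1 < u) :
    densF R S δ M u ≤ 2 * ((sizeBound R S M * normBound R S * Real.exp (normBound R S) +
      (1 + (3 + 2 * Hc R S) * (1 + Multiset.card S + Multiset.card R) + M)) +
      (1 + (3 + 2 * Hc R S) * (1 + Multiset.card S + Multiset.card R) + M)) * ((1 - u⁻¹) / Real.log u) := by
  set Cg : ℝ := sizeBound R S M * normBound R S * Real.exp (normBound R S) +
    (1 + (3 + 2 * Hc R S) * (1 + Multiset.card S + Multiset.card R) + M) with hCg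
  set CF : ℝ := 1 + (3 + 2 * Hc R S) * (1 + Multiset.card S + Multiset.card R) + M with hCF
  have hB := sizeBound_nonneg (R := R) (S := S) (M := M)
  have hQ := normBound_nonneg (R := R) (S := S)
  have hH := one_le_Hc R S
  have hCF0 : 0 ≤ CF := by positivity
  have hCg0 : 0 ≤ Cg := by positivity
  have hglob : densF R S δ M u ≤ Cg := (le_abs_self _).trans (abs_densF_le hS hR hδ hδ1 (fun _ hx ↦ hpos _ (Real.log_pos hx)) u)
  have hdiv : densF R S δ M u ≤ CF / Real.log u := densF_le_div_log hS hR hδ hδ1 hu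
  have hLi0 : 0 ≤ (1 - u⁻¹) / Real.log u := Li_integrand_nonneg hu
  rcases le_or_gt u 2 with hu2 | hu2
  · have h := half_le_Li_integrand hu hu2
    calc densF R S δ M u ≤ Cg := hglob
      _ = 2 * Cg * (1 / 2) := by ring
      _ ≤ 2 * Cg * ((1 - u⁻¹) / Real.log u) := mul_le_mul_of_nonneg_left h (by positivity)
      _ ≤ 2 * (Cg + CF) * ((1 - u⁻¹) / Real.log u) := by nlinarith
  · have h := inv_two_log_le_Li_integrand hu2.le
    have hlog : 0 < Real.log u := Real.log_pos hu
    calc densF R S δ M u ≤ CF / Real.log u := hdiv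
      _ = 2 * CF * (1 / (2 * Real.log u)) := by field_simp
      _ ≤ 2 * CF * ((1 - u⁻¹) / Real.log u) := mul_le_mul_of_nonneg_left h (by positivity)
      _ ≤ 2 * (Cg + CF) * ((1 - u⁻¹) / Real.log u) := by nlinarith

/-- **`F(x) ≤ K Li(x)`** for `x ≥ 1` (comparison of derivatives, both sides vanishing at `1`).
[cite: BrouckeDebruyneRevesz2023, proof of Theorem 3.2 ("F(x) ≪ x/log x")] -/
theorem tmplF_le_mul_Li (hS : ∀ ω ∈ S, ω.re ≤ 1) (hR : ∀ ρ ∈ R, ρ.re ≤ 1) (hδ : 0 ≤ δ) (hδ1 : δ ≤ 1)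
    (hpos : ∀ L : ℝ, 0 < L → 0 ≤ NF R S δ M L) {x : ℝ} (hx : 1 ≤ x) :
    tmplF R S δ M x ≤ 2 * ((sizeBound R S M * normBound R S * Real.exp (normBound R S) +
      (1 + (3 + 2 * Hc R S) * (1 + Multiset.card S + Multiset.card R) + M)) +
      (1 + (3 + 2 * Hc R S) * (1 + Multiset.card S + Multiset.card R) + M)) * Li x := by
  set K : ℝ := 2 * ((sizeBound R S M * normBound R S * Real.exp (normBound R S) +
      (1 + (3 + 2 * Hc R S) * (1 + Multiset.card S + Multiset.card R) + M)) +
      (1 + (3 + 2 * Hc R S) * (1 + Multiset.card S + Multiset.card R) + M)) with hK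
  -- `h(t) = K Li t − F t` is monotone on `[1, x]`
  set h : ℝ → ℝ := fun t ↦ K * Li t - tmplF R S δ M t with hh
  have hcont : ContinuousOn h (Icc 1 x) :=
    ((continuousOn_Li x).const_smul K).sub (continuous_tmplF hδ hδ1).continuousOn
  have hderiv : ∀ t ∈ interior (Icc 1 x), HasDerivAt h (K * ((1 - t⁻¹) / Real.log t) - densF R S δ M t) t := by
    intro t ht
    rw [interior_Icc] at ht
    exact ((hasDerivAt_Li ht.1).const_mul K).sub (hasDerivAt_tmplF hδ hδ1 ht.1)
  have hmono : MonotoneOn h (Icc 1 x) := by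
    refine monotoneOn_of_deriv_nonneg (convex_Icc 1 x) hcont (fun t ht ↦ (hderiv t ht).differentiableAt.differentiableWithinAt) ?_
    intro t ht
    rw [(hderiv t ht).deriv]
    rw [interior_Icc] at ht
    have := densF_le_mul_Li_integrand (M := M) hS hR hδ hδ1 hpos ht.1
    rw [← hK] at this
    linarith
  have h1 : h 1 ≤ h x := hmono ⟨le_rfl, hx⟩ ⟨hx, le_rfl⟩ hx
  simp only [hh, Li_one, mul_zero, tmplF_of_le_one (le_refl (1:ℝ)), sub_zero] at h1
  linarith

/-- **The Chebyshev bound `F(x) ≤ C x/log x` for `x ≥ 2`** (hypothesis of Theorem 1.2; BDR: "admits a bound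
`F(x) ≪ x/log x`"), via `Li(x) ≤ 2x/log x` (tree `Li_le`). [cite: BrouckeDebruyneRevesz2023, proof of Theorem 3.2] -/
theorem tmplF_chebyshev (hS : ∀ ω ∈ S, ω.re ≤ 1) (hR : ∀ ρ ∈ R, ρ.re ≤ 1) (hδ : 0 ≤ δ) (hδ1 : δ ≤ 1)
    (hpos : ∀ L : ℝ, 0 < L → 0 ≤ NF R S δ M L) :
    ∃ C : ℝ, ∀ x : ℝ, 2 ≤ x → tmplF R S δ M x ≤ C * x / Real.log x := by
  set K : ℝ := 2 * ((sizeBound R S M * normBound R S * Real.exp (normBound R S) +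
      (1 + (3 + 2 * Hc R S) * (1 + Multiset.card S + Multiset.card R) + M)) +
      (1 + (3 + 2 * Hc R S) * (1 + Multiset.card S + Multiset.card R) + M)) with hK
  have hB := sizeBound_nonneg (R := R) (S := S) (M := M)
  have hQ := normBound_nonneg (R := R) (S := S)
  have hH := one_le_Hc R S
  have hK0 : 0 ≤ K := by positivity
  refine ⟨2 * K, fun x hx ↦ ?_⟩
  have h1 := tmplF_le_mul_Li (M := M) hS hR hδ hδ1 hpos (by linarith : (1:ℝ) ≤ x)
  rw [← hK] at h1
  have h2 := Li_le (by linarith : (1:ℝ) < x)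
  calc tmplF R S δ M x ≤ K * Li x := h1
    _ ≤ K * (2 * x / Real.log x) := mul_le_mul_of_nonneg_left h2 hK0
    _ = 2 * K * x / Real.log x := by ring

/-! ### `F → ∞` -/

/-- **`F(x) ≥ (x − X₀)/(2 log x)` for `x ≥ X₀`** (from `NF₀(log t) ≥ t/2`, so `F′(t) ≥ 1/(2 log t) ≥ 1/(2 log x)` on
`[X₀, x]`). [cite: BrouckeDebruyneRevesz2023, proof of Lemma 3.1] -/
theorem tmplF_ge_of_half_le (hδ : 0 ≤ δ) (hδ1 : δ ≤ 1) {X0 : ℝ} (hX0 : 1 < X0)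
    (hhalf : ∀ t : ℝ, X0 ≤ t → t / 2 ≤ NF R S δ M (Real.log t))
    (hpos : ∀ L : ℝ, 0 < L → 0 ≤ NF R S δ M L) {x : ℝ} (hx : X0 ≤ x) :
    (x - X0) / (2 * Real.log x) ≤ tmplF R S δ M x := by
  have hx1 : 1 < x := lt_of_lt_of_le hX0 hx
  have hlogx : 0 < Real.log x := Real.log_pos hx1
  -- `h(t) = F t − t/(2 log x)` is monotone on `[X0, x]`
  set h : ℝ → ℝ := fun t ↦ tmplF R S δ M t - t / (2 * Real.log x) with hh
  have hcont : ContinuousOn h (Icc X0 x) :=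
    ((continuous_tmplF hδ hδ1).continuousOn).sub (continuousOn_id.div_const _)
  have hderiv : ∀ t ∈ interior (Icc X0 x), HasDerivAt h (densF R S δ M t - 1 / (2 * Real.log x)) t := by
    intro t ht
    rw [interior_Icc] at ht
    have h1 := hasDerivAt_tmplF (R := R) (S := S) (M := M) hδ hδ1 (lt_trans hX0 ht.1)
    have h2 : HasDerivAt (fun t : ℝ ↦ t / (2 * Real.log x)) (1 / (2 * Real.log x)) t := by
      simpa using (hasDerivAt_id t).div_const (2 * Real.log x)
    exact h1.sub h2
  have hmono : MonotoneOn h (Icc X0 x) := by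
    refine monotoneOn_of_deriv_nonneg (convex_Icc X0 x) hcont
      (fun t ht ↦ (hderiv t ht).differentiableAt.differentiableWithinAt) ?_
    intro t ht
    rw [(hderiv t ht).deriv]
    rw [interior_Icc] at ht
    have ht1 : 1 < t := lt_trans hX0 ht.1
    have ht0 : 0 < t := by linarith
    have hlogt : 0 < Real.log t := Real.log_pos ht1
    have hlogtx : Real.log t ≤ Real.log x := Real.log_le_log ht0 ht.2.le
    have hNF := hhalf t ht.1.le
    rw [densF_of_one_lt ht1, sub_nonneg, div_le_div_iff₀ (by positivity) (by positivity)]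
    nlinarith
  have h1 : h X0 ≤ h x := hmono ⟨le_rfl, hx⟩ ⟨hx, le_rfl⟩ hx
  simp only [hh] at h1
  have hF0 : 0 ≤ tmplF R S δ M X0 := tmplF_nonneg hδ hδ1 hpos X0
  rw [sub_div]
  linarith

/-- **`F → ∞`** (when `NF ≥ 0` on `(0,∞)` and `Re ω, Re ρ < 1`). [cite: BrouckeDebruyneRevesz2023, proof of Theorem 3.2] -/
theorem tendsto_tmplF_atTop (hS : ∀ ω ∈ S, ω.re < 1) (hR : ∀ ρ ∈ R, ρ.re < 1) (hδ : 0 ≤ δ) (hδ1 : δ ≤ 1)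
    (hpos : ∀ L : ℝ, 0 < L → 0 ≤ NF R S δ M L) : Tendsto (tmplF R S δ M) atTop atTop := by
  obtain ⟨X0', hX0'1, hhalf'⟩ := exists_X0_half_le_NF0 (R := R) (S := S) (δ := δ) hS hR
  set X0 : ℝ := max X0' 2 with hX0
  have hX0gt : 1 < X0 := lt_of_lt_of_le one_lt_two (le_max_right _ _)
  have hhalf : ∀ t : ℝ, X0 ≤ t → t / 2 ≤ NF R S δ M (Real.log t) := fun t ht ↦
    (hhalf' t (le_trans (le_max_left _ _) ht)).trans (NF0_le_NF hδ (Real.log_nonneg (le_trans hX0gt.le ht)))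
  -- lower bound `(x − X0)/(2 log x) ≥ (x − X0)/(4 √x) = √x/4 − X0/(4√x)`
  have hlow : ∀ x : ℝ, X0 ≤ x → Real.sqrt x / 4 - X0 / 4 ≤ tmplF R S δ M x := by
    intro x hx
    have hx1 : 1 < x := lt_of_lt_of_le hX0gt hx
    have hx0 : 0 < x := by linarith
    have h1 := tmplF_ge_of_half_le hδ hδ1 hX0gt hhalf hpos hx
    have hlog : Real.log x ≤ 2 * Real.sqrt x := by
      have := Real.log_le_rpow_div hx0.le (by norm_num : (0:ℝ) < 1 / 2)
      rw [Real.sqrt_eq_rpow]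
      linarith
    have hlogpos : 0 < Real.log x := Real.log_pos hx1
    have hsqrt1 : 1 ≤ Real.sqrt x := by rw [Real.le_sqrt (by norm_num) hx0.le]; linarith
    have h2 : (x - X0) / (4 * Real.sqrt x) ≤ (x - X0) / (2 * Real.log x) :=
      div_le_div_of_nonneg_left (by linarith) (by positivity) (by linarith)
    have h3 : Real.sqrt x / 4 - X0 / 4 ≤ (x - X0) / (4 * Real.sqrt x) := by
      rw [le_div_iff₀ (by positivity)]
      have hsq : Real.sqrt x * Real.sqrt x = x := Real.mul_self_sqrt hx0.le
      nlinarith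
    linarith
  have htend : Tendsto (fun x : ℝ ↦ Real.sqrt x / 4 - X0 / 4) atTop atTop := by
    have h1 : Tendsto (fun x : ℝ ↦ x ^ (1 / 2 : ℝ)) atTop atTop := tendsto_rpow_atTop (by norm_num)
    have h2 : Tendsto (fun x : ℝ ↦ Real.sqrt x / 4) atTop atTop := by
      refine (h1.atTop_div_const (by norm_num : (0:ℝ) < 4)).congr fun x ↦ ?_
      rw [Real.sqrt_eq_rpow]
    exact tendsto_atTop_add_const_right _ _ h2
  refine tendsto_atTop_mono' atTop ?_ htend
  filter_upwards [eventually_ge_atTop X0] with x hx using hlow x hx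

end BDRMultiset

end Literature.NumberTheory.BeurlingPrimes
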